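import Summits.QuantumFields.YangMills.Theorems.PoincareLipschitzLinearTail
import Summits.QuantumFields.YangMills.Theorems.PoincareLipschitzExpConcentrationOfVariance
import HarnessLib

/-!
# Crux `HistoryTailL` (stmt-QuantumFields-19936), line #12 — THE POINCARÉ KNIT:
# `HistoryTailL ⟸ (variance bound at the Hodge–Poincaré scale) ∧ BlockLipschitzL ∧ MeanDeviationL`

Cell `ym3-torus` (YM ladder rung R3 = continuum SU(2) Yang–Mills on the 3-torus — NOT d = 4, NOT infinite volume, NOT a mass gap, NOT the Clay
problem), width seat `ym-ust-19936-w3` gen 13; `--supports stmt-QuantumFields-19936 --as helper`.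

The composition of ★w4 g12's p-linear glue ✓`PoincareLipschitzLinear.historyTailL_of_expConcentration`
(`HistoryTailL ⟸ K1-exp ∧ BlockLipschitzL ∧ MeanDeviationL`) with the Poincaré door
✓`PoincareLipschitzExpConcentrationOfVariance.expConcentration_of_varianceBound` (K1-exp ⟸ `hVar`, Gromov–Milman ∕ Aida–Stroock):

* ★★★`historyTailL_of_varianceBound (hVar) (hLip : BlockLipschitzL) (hM : MeanDeviationL) : UnitScaleTilt.HistoryTailL` BY NAME.

So, BY KERNEL, line #12 closes the crux `HistoryTailL` from a SPECTRAL GAP ∕ POINCARÉ INEQUALITY for the cut-off Gibbs law `gibbsK` on box-local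
gauge-invariant `Λ`-Lipschitz observables at the Hodge–Poincaré scale — in the integrated form
`Var_{gibbsK}(e^{lf∕2}) ≤ cV·(n²Λ²∕β_K)·l²·∫ e^{lf} d gibbsK` for all real `l`, constants depending on `L` only, uniform in the torus side and in
`1 ≤ n ≤ β_K` — plus K2 = `BlockLipschitzL` (stmt-QuantumFields-23533) and the shared first-moment crux `MeanDeviationL` (stmt-QuantumFields-23083).
The registered Gaussian crux `MesoscopicConcentrationL` (log-Sobolev class, Herbst face ✓`mesoscopicConcentrationL_of_entropyBound`) is the
stronger sibling (✓`expTail_of_gaussTail`); the thesis risk (i) of route PoincareLipschitz («Gribov ∕ non-convex orbit geometry may give only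
exponential (Poincaré) not Gaussian (LSI) concentration at scale n²∕β_K») is thereby harmless for the crux.

HONEST: route glue.  `hVar` (a weak-coupling spectral gap for SU(2) lattice gauge theory at the box's Hodge scale), `BlockLipschitzL` (⟸ `hRegH` ⟸
`hImprove` ∧ …, LEAD's knit of record) and `MeanDeviationL` are OPEN; nothing of K1∕K2, the cruxes, rung R3 or the mass gap is proved here.  No
spectral-gap ∕ log-Sobolev statement for a continuous gauge group at weak coupling is in print ([arXiv:2204.12737] Assumption 1.1 is strong
coupling).  THEOREMS ONLY, definition-free.
[cite: BakryGentilLedoux2014, Prop. 4.4.2; GromovMilman1983, Thm. 4.1; Balaban1985UV3, (7) p.257 and (71) p.273]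
-/

set_option autoImplicit false

noncomputable section

namespace Summit.QuantumFields.YangMills.Theorems.PoincareLipschitzHistoryTailOfVarianceBound

open MeasureTheory
open scoped BigOperators
open Literature.MathematicalPhysics.QuantumFieldTheory.Balaban1983to89
open Literature.MathematicalPhysics.QuantumFieldTheory.Balaban1983to89.T3ContinuumYM3Torus
open Literature.MathematicalPhysics.QuantumFieldTheory.Balaban1983to89.T3UnitScaleTilt
open Literature.MathematicalPhysics.QuantumFieldTheory.Balaban1983to89.T3UnitLawDensityEML (ℰp)
open Summit.QuantumFields.YangMills.Theorems.PoincareLipschitzLinear (historyTailL_of_expConcentration)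
open Summit.QuantumFields.YangMills.Theorems.PoincareLipschitzExpConcentrationOfVariance (expConcentration_of_varianceBound)

/-- ★★★ **`HistoryTailL ⟸ POINCARÉ (variance bound at the Hodge–Poincaré scale) ∧ BlockLipschitzL ∧ MeanDeviationL`**, BY NAME.
Hypothesis `hVar`: for every `L` there are `cV > 0` and `γ₁ ∈ (0,1]` such that for every `T3Family F` with `F.L = L`, every `γ ∈ (0,γ₁]`, every
`K`, every box side `1 ≤ n ≤ β_K` with `2n ≤ sitesPerDir`, every corner `x₀`, every measurable gauge-invariant `f` depending only on the bonds of
the box `x₀ + [0,n)³` and `Λ`-Lipschitz (`Λ > 0`) in the `ℓ²` link metric, and every real `l`: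
`∫ e^{lf} d gibbsK − (∫ e^{(l∕2)f} d gibbsK)² ≤ cV·(n²Λ²∕β_K)·l²·∫ e^{lf} d gibbsK` (the Poincaré inequality for `gibbsK` at constant `≍ n²∕β_K`,
applied to `e^{lf∕2}`).  Conclusion: the crux decl `Summit.QuantumFields.YangMills.Theses.UnitScaleTilt.HistoryTailL`.
Proof: ✓`historyTailL_of_expConcentration` ∘ ✓`expConcentration_of_varianceBound`.  Route glue; `hVar`, `BlockLipschitzL`, `MeanDeviationL` are
NOT proved. [cite: BakryGentilLedoux2014, Prop. 4.4.2; Balaban1985UV3, (71) p.273] -/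
theorem historyTailL_of_varianceBound
    (hVar : ∀ (L : ℕ), ∃ cV : ℝ, 0 < cV ∧ ∃ γ₁ : ℝ, 0 < γ₁ ∧ γ₁ ≤ 1 ∧
      ∀ (F : T3Family) (γ : ℝ), F.L = L → 0 < γ → γ ≤ γ₁ → ∀ (K n : ℕ), 1 ≤ n →
        (n : ℝ) ≤ (F.scheme ℰp γ).β K → 2 * n ≤ (F.P K).sitesPerDir 0 →
        ∀ (x₀ : Site (F.P K) 0) (f : GaugeField (F.P K) 0 (Matrix.specialUnitaryGroup (Fin 2) ℂ) → ℝ) (Λ : ℝ), 0 < Λ →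
          Measurable f → GaugeField.GaugeInvariant f →
          (∀ U U' : GaugeField (F.P K) 0 (Matrix.specialUnitaryGroup (Fin 2) ℂ),
            (∀ b : PBond (F.P K) 0, (∀ k, (b.src k - x₀ k).val < n) → (∀ k, (b.tgt k - x₀ k).val < n) → U b = U' b) →
              f U = f U') →
          (∀ U U' : GaugeField (F.P K) 0 (Matrix.specialUnitaryGroup (Fin 2) ℂ),
            |f U - f U'| ≤ Λ * Real.sqrt (∑ b : PBond (F.P K) 0, GaugeGroup.dist1 (U b * (U' b)⁻¹) ^ 2)) →
          ∀ l : ℝ,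
            ∫ U, Real.exp (l * f U) ∂(gibbsK F ℰp γ K) - (∫ U, Real.exp (l / 2 * f U) ∂(gibbsK F ℰp γ K)) ^ 2 ≤
              cV * ((n : ℝ) ^ 2 * Λ ^ 2 / (F.scheme ℰp γ).β K) * l ^ 2 * ∫ U, Real.exp (l * f U) ∂(gibbsK F ℰp γ K))
    (hLip : Summit.QuantumFields.YangMills.Theses.PoincareLipschitz.BlockLipschitzL)
    (hM : Summit.QuantumFields.YangMills.Theses.PoincareLipschitz.MeanDeviationL) :
    Summit.QuantumFields.YangMills.Theses.UnitScaleTilt.HistoryTailL :=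
  historyTailL_of_expConcentration (expConcentration_of_varianceBound hVar) hLip hM

end Summit.QuantumFields.YangMills.Theorems.PoincareLipschitzHistoryTailOfVarianceBound

end
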